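import Literature.Analysis.Convexity.AnisotropicIsoperimetric
import Literature.Analysis.Convexity.AnisotropicPerimeter
import Literature.MeasureTheory.Integral.EuclideanDivergenceCoords
import Mathlib.Analysis.Calculus.Rademacher
import HarnessLib

/-!
# The anisotropic perimeter of the Wulff shape itself: `P_K(K) = n · vol(K)`

Topic `Literature/Analysis/Convexity`; namespace `Literature.Analysis.Convexity`. A complement to
the series `AnisotropicIsoperimetric*.lean` (the Wulff inequality
`P_K(G) ≥ n |K|^{1/n} |G|^{(n-1)/n}`, `anisotropic_isoperimetric_inequality`) and to
`AnisotropicPerimeter.lean` (`anisotropicPerimeter K A = sup {∫_A div φ : φ ∈ C¹_c, φ(x) ∈ K}`).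

**Theorem** (`anisotropicPerimeter_self`; Maggi 2012, Proposition 20.10 (iii), eq. (20.11)
`Φ(W_Φ) = n |W_Φ|`). For `n ≥ 2` and `K ⊆ ℝⁿ` compact convex with `0 ∈ K`,

  `anisotropicPerimeter K K = n · vol(K)`,

i.e. the Wulff shape realises equality in the Wulff inequality. The upper bound
`anisotropicPerimeter K K ≤ n · vol(K)` (`anisotropicPerimeter_self_le`) holds for every compact
convex `K` in every dimension (no `0 ∈ K`, no `n ≥ 2`).

Printed proof of (20.11): the divergence theorem for the identity field on `W_Φ` and the equality
cases of the Fenchel inequality on `∂* W_Φ`. The tree has no Gauss–Green theorem for general convex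
bodies, so the upper bound is proved here WITHOUT structure theory, by an inner variation: for an
admissible field `φ` (`C¹_c`, `φ(x) ∈ K`) and the mollified indicator `u = ρ ⋆ χ_K`,
`∫_K div φ = lim ∫ u div φ = -lim ∫ Du[φ]` (integration by parts), and
`-∫ Du(x)[φ(x)] dx = lim_{t↓0} t⁻¹ ∫ (u(x) - u(x + tφ(x))) dx ≤ lim t⁻¹ (|K| - |(1-t)K|) = n|K|`,
because `u(x + tφ(x)) ≥ (ρ ⋆ χ_{(1-t)K})(x)` pointwise — the EROSION inclusion
`(1-t)K + tK ⊆ K` (convexity) — and `∫ ρ ⋆ χ_A = |A|`. The lower bound is the Wulff inequality of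
the series with `G = K`.

Corollaries: `perimeter_closedBall` (`Per(B̄_r) = n r^{n-1} |B̄₁|`, De Giorgi's perimeter of
`FccTexturedSet.lean`); with `volume_fccWulffBody` (`FccWulffBodyHull.lean`, `|W| = 32`) the case
`n = 3`, `K = W` the fcc Wulff body gives `P_W(W) = 3 · 32 = 96`, the one-grain equality case of
the crux `PolycrystalWulffBound` of the venture `Summits/Ventures/Crystal3D`.

WHAT IS NOT HERE: uniqueness of the Wulff shape among equality cases (Taylor 1978,
Fonseca–Müller 1991); the facet formula (see `AnisotropicPerimeterPolytopeFacetFormula.lean`).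

## References
* F. Maggi, *Sets of Finite Perimeter and Geometric Variational Problems*, CUP 2012, §20.1,
  Proposition 20.10 (iii), eq. (20.11); Theorem 20.8 and (20.14). [`Maggi2012`]
* L. C. Evans, R. F. Gariepy, *Measure Theory and Fine Properties of Functions*, revised ed. 2015,
  §5.2.2 Thm 5.3 (mollification). [`EvansGariepy2015`]
-/

noncomputable section

open Set Filter Function Metric
open _root_.MeasureTheory _root_.MeasureTheory.Measure ContinuousLinearMap
open scoped ENNReal NNReal Topology Convolution Pointwise

namespace Literature.Analysis.Convexity

open Literature.MathematicalPhysics.StatisticalMechanics (fieldDivergence perimeter)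
open Literature.MeasureTheory.Integral (fieldDivergence_eq_sum)

variable {n : ℕ}

/-! ### Elementary facts on mollified indicators -/

/-- The convolution integrand `s ↦ ρ(s) · g(x - s)` is integrable for `ρ` continuous compactly
supported and `g` bounded measurable. [folklore] -/
private theorem integrable_mul_comp_sub {ρ g : EuclideanSpace ℝ (Fin n) → ℝ} (hρc : Continuous ρ)
    (hcρ : HasCompactSupport ρ) (hgm : Measurable g) {C : ℝ} (hgC : ∀ y, ‖g y‖ ≤ C)
    (x : EuclideanSpace ℝ (Fin n)) :
    Integrable (fun s => ρ s * g (x - s)) volume := by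
  have hρi : Integrable ρ volume := hρc.integrable_of_hasCompactSupport hcρ
  have hm : AEStronglyMeasurable (fun s => g (x - s)) volume :=
    (hgm.comp (measurable_const.sub measurable_id)).aestronglyMeasurable
  have := hρi.bdd_mul (c := C) hm (Eventually.of_forall fun s => hgC (x - s))
  simpa [mul_comm] using this

/-- Indicators are bounded by `1`. [folklore] -/
private theorem norm_indicator_one_le (A : Set (EuclideanSpace ℝ (Fin n)))
    (y : EuclideanSpace ℝ (Fin n)) : ‖A.indicator (fun _ => (1 : ℝ)) y‖ ≤ 1 := by
  by_cases hy : y ∈ A <;> simp [hy]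

/-- `0 ≤ (ρ ⋆ χ_A)(x) ≤ ∫ ρ` for a kernel `ρ ≥ 0`. [folklore] -/
private theorem convolution_indicator_mem_Icc {ρ : EuclideanSpace ℝ (Fin n) → ℝ}
    (hρc : Continuous ρ) (hcρ : HasCompactSupport ρ) (hρ0 : ∀ s, 0 ≤ ρ s)
    {A : Set (EuclideanSpace ℝ (Fin n))} (hA : MeasurableSet A) (x : EuclideanSpace ℝ (Fin n)) :
    (ρ ⋆[lsmul ℝ ℝ, volume] (A.indicator fun _ => (1 : ℝ))) x ∈ Icc 0 (∫ s, ρ s) := by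
  have hint := integrable_mul_comp_sub hρc hcρ (measurable_const.indicator hA)
    (norm_indicator_one_le A) x
  rw [convolution_lsmul]
  simp only [smul_eq_mul]
  refine ⟨integral_nonneg fun s => mul_nonneg (hρ0 s)
      (indicator_nonneg (fun _ _ => zero_le_one) _), ?_⟩
  refine integral_mono hint (hρc.integrable_of_hasCompactSupport hcρ) fun s => ?_
  have h1 : A.indicator (fun _ => (1 : ℝ)) (x - s) ≤ 1 := by
    by_cases h : x - s ∈ A <;> simp [h]
  simpa using mul_le_mul_of_nonneg_left h1 (hρ0 s)

/-- `∫ ρ ⋆ χ_A = (∫ ρ) · vol(A)` for `A` of finite volume. [folklore] -/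
private theorem integral_convolution_indicator {ρ : EuclideanSpace ℝ (Fin n) → ℝ}
    (hρc : Continuous ρ) (hcρ : HasCompactSupport ρ)
    {A : Set (EuclideanSpace ℝ (Fin n))} (hA : MeasurableSet A) (hAfin : volume A < ⊤) :
    ∫ x, (ρ ⋆[lsmul ℝ ℝ, volume] (A.indicator fun _ => (1 : ℝ))) x =
      (∫ s, ρ s) * (volume A).toReal := by
  have hχi : Integrable (A.indicator fun _ => (1 : ℝ)) volume :=
    (integrable_indicator_iff hA).2 (integrableOn_const hAfin.ne)
  rw [integral_convolution (lsmul ℝ ℝ) (hρc.integrable_of_hasCompactSupport hcρ) hχi,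
    lsmul_apply, smul_eq_mul, integral_indicator hA, setIntegral_const, smul_eq_mul, mul_one,
    measureReal_def]

/-! ### Erosion: `(1 - t) K + t K ⊆ K` -/

/-- **Erosion.** For `K` convex, `t ∈ [0, 1]`, `v ∈ K` and a kernel `ρ ≥ 0`:
`(ρ ⋆ χ_{(1-t)K})(x) ≤ (ρ ⋆ χ_K)(x + t v)` — because `y ∈ (1-t)K ⇒ y + tv ∈ K` by convexity.
This is the only place where convexity of `K` enters the upper bound (it replaces the equality
cases of the Fenchel inequality in Maggi's proof of (20.11)). [folklore] -/
private theorem convolution_indicator_smul_le {ρ : EuclideanSpace ℝ (Fin n) → ℝ} (hρc : Continuous ρ)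
    (hcρ : HasCompactSupport ρ) (hρ0 : ∀ s, 0 ≤ ρ s)
    {K : Set (EuclideanSpace ℝ (Fin n))} (hKc : Convex ℝ K) (hKm : MeasurableSet K)
    {t : ℝ} (ht0 : 0 ≤ t) (ht1 : t ≤ 1) {v : EuclideanSpace ℝ (Fin n)} (hv : v ∈ K)
    (x : EuclideanSpace ℝ (Fin n)) :
    (ρ ⋆[lsmul ℝ ℝ, volume] (((1 - t) • K).indicator fun _ => (1 : ℝ))) x ≤
      (ρ ⋆[lsmul ℝ ℝ, volume] (K.indicator fun _ => (1 : ℝ))) (x + t • v) := by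
  have hKtm : MeasurableSet ((1 - t) • K) := by
    rcases eq_or_lt_of_le ht1 with rfl | hlt
    · by_cases hKe : K.Nonempty
      · rw [sub_self, zero_smul_set hKe]; exact measurableSet_singleton 0
      · rw [Set.not_nonempty_iff_eq_empty.1 hKe, smul_set_empty]; exact MeasurableSet.empty
    · exact hKm.const_smul₀ (1 - t)
  rw [convolution_lsmul, convolution_lsmul]
  refine integral_mono
    (integrable_mul_comp_sub hρc hcρ (measurable_const.indicator hKtm)
      (norm_indicator_one_le _) x)
    (integrable_mul_comp_sub hρc hcρ (measurable_const.indicator hKm)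
      (norm_indicator_one_le _) (x + t • v)) fun s => ?_
  simp only [smul_eq_mul]
  refine mul_le_mul_of_nonneg_left ?_ (hρ0 s)
  by_cases hs : x - s ∈ (1 - t) • K
  · obtain ⟨a, ha, has⟩ := Set.mem_smul_set.1 hs
    have hmem : x + t • v - s = (1 - t) • a + t • v := by
      rw [has]; abel
    have hK' : x + t • v - s ∈ K := by
      rw [hmem]; exact hKc ha hv (by linarith) ht0 (by ring)
    rw [indicator_of_mem hs, indicator_of_mem hK']
  · rw [indicator_of_notMem hs]
    exact indicator_nonneg (fun _ _ => zero_le_one) _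

/-! ### The inner variation along a `K`-valued field -/

/-- **Inner-variation estimate (the heart of the upper bound).** Let `K ⊆ ℝⁿ` be compact convex,
`u = ρ ⋆ χ_K` for a `C¹_c` kernel `ρ ≥ 0` with `∫ ρ = 1`, and `φ` a continuous compactly supported
field with `φ(x) ∈ K` for all `x`. Then `-∫ Du(x)[φ(x)] dx ≤ n · vol(K)`.
Proof: `G(t) = ∫ (u(x + tφ(x)) - u(x)) dx` has `G(0) = 0`, `G'(0) = ∫ Du[φ]` (differentiation under
the integral), and `G(t) ≥ |(1-t)K| - |K| = ((1-t)ⁿ - 1)|K| ≥ -n t |K|` for `t ∈ (0,1]` by the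
erosion lemma and Bernoulli's inequality.
[cite: Maggi2012, Proposition 20.10 (iii), eq. (20.11) p. 263 (upper bound; proved here by inner variation)] -/
theorem neg_integral_fderiv_convolution_indicator_apply_le
    {ρ : EuclideanSpace ℝ (Fin n) → ℝ} (hρ : ContDiff ℝ 1 ρ) (hcρ : HasCompactSupport ρ)
    (hρ0 : ∀ s, 0 ≤ ρ s) (hρ1 : ∫ s, ρ s = 1)
    {K : Set (EuclideanSpace ℝ (Fin n))} (hK : IsCompact K) (hKc : Convex ℝ K)
    {φ : EuclideanSpace ℝ (Fin n) → EuclideanSpace ℝ (Fin n)} (hφc : Continuous φ)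
    (hcφ : HasCompactSupport φ) (hφK : ∀ x, φ x ∈ K) :
    -(∫ x, fderiv ℝ (ρ ⋆[lsmul ℝ ℝ, volume] (K.indicator fun _ => (1 : ℝ))) x (φ x)) ≤
      n * (volume K).toReal := by
  have hKm : MeasurableSet K := hK.isClosed.measurableSet
  have hKfin : volume K < ⊤ := hK.measure_lt_top
  have hρc : Continuous ρ := hρ.continuous
  set χ : EuclideanSpace ℝ (Fin n) → ℝ := K.indicator fun _ => (1 : ℝ) with hχ
  have hχi : Integrable χ volume := (integrable_indicator_iff hKm).2 (integrableOn_const hKfin.ne)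
  have hcχ : HasCompactSupport χ := HasCompactSupport.intro hK fun x hx => by simp [hχ, hx]
  set u : EuclideanSpace ℝ (Fin n) → ℝ := ρ ⋆[lsmul ℝ ℝ, volume] χ with hu
  have huC : ContDiff ℝ 1 u := hcρ.contDiff_convolution_left _ hρ hχi.locallyIntegrable
  have hcu : HasCompactSupport u := hcρ.convolution _ hcχ
  have hud : Differentiable ℝ u := huC.differentiable one_ne_zero
  have hDuc : Continuous (fderiv ℝ u) := huC.continuous_fderiv one_ne_zero
  obtain ⟨C, hC⟩ : ∃ C, ∀ x, ‖fderiv ℝ u x‖ ≤ C :=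
    hDuc.bounded_above_of_compact_support (hcu.fderiv (𝕜 := ℝ))
  set V : ℝ := (volume K).toReal with hV
  -- the family `G(t) = ∫ (u(x + tφ(x)) - u(x)) dx` and its derivative at `0`
  set F : ℝ → EuclideanSpace ℝ (Fin n) → ℝ := fun t x => u (x + t • φ x) - u x with hF
  set F' : ℝ → EuclideanSpace ℝ (Fin n) → ℝ := fun t x => fderiv ℝ u (x + t • φ x) (φ x) with hF'
  have hFc : ∀ t, Continuous (F t) := fun t =>
    (hud.continuous.comp (continuous_id.add (hφc.const_smul t))).sub hud.continuous
  have hderiv : HasDerivAt (fun t => ∫ x, F t x) (∫ x, F' 0 x) 0 := by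
    refine (hasDerivAt_integral_of_dominated_loc_of_deriv_le (μ := volume) (F := F) (F' := F')
      (x₀ := (0 : ℝ)) (s := univ) (bound := fun x => C * ‖φ x‖) univ_mem ?_ ?_ ?_ ?_ ?_ ?_).2
    · exact Eventually.of_forall fun t => (hFc t).aestronglyMeasurable
    · have : F 0 = fun _ => 0 := by funext x; simp [hF]
      rw [this]; exact integrable_zero _ _ _
    · exact ((hDuc.comp (continuous_id.add (hφc.const_smul (0 : ℝ)))).clm_apply hφc)
        |>.aestronglyMeasurable
    · refine Eventually.of_forall fun x t _ => ?_
      calc ‖F' t x‖ ≤ ‖fderiv ℝ u (x + t • φ x)‖ * ‖φ x‖ := le_opNorm _ _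
        _ ≤ C * ‖φ x‖ := by gcongr; exact hC _
    · exact (continuous_const.mul hφc.norm).integrable_of_hasCompactSupport hcφ.norm.mul_left
    · refine Eventually.of_forall fun x t _ => ?_
      have hγ : HasDerivAt (fun t : ℝ => x + t • φ x) (φ x) t := by
        simpa using ((hasDerivAt_id t).smul_const (φ x)).const_add x
      have := ((hud (x + t • φ x)).hasFDerivAt.comp_hasDerivAt t hγ).sub_const (u x)
      simpa [hF, hF'] using this
  -- `G(0) = 0`
  have hG0 : (∫ x, F 0 x) = 0 := by simp [hF]
  -- erosion: `G(t) ≥ -n t V` on `(0, 1]`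
  have hGt : ∀ t ∈ Ioc (0 : ℝ) 1, -(n * t * V) ≤ ∫ x, F t x := by
    intro t ht
    set χt : EuclideanSpace ℝ (Fin n) → ℝ := ((1 - t) • K).indicator fun _ => (1 : ℝ) with hχt
    set ut : EuclideanSpace ℝ (Fin n) → ℝ := ρ ⋆[lsmul ℝ ℝ, volume] χt with hut
    have hKt : IsCompact ((1 - t) • K) := hK.smul (1 - t)
    have hKtm : MeasurableSet ((1 - t) • K) := hKt.isClosed.measurableSet
    have hχti : Integrable χt volume :=
      (integrable_indicator_iff hKtm).2 (integrableOn_const hKt.measure_lt_top.ne)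
    have hcχt : HasCompactSupport χt :=
      HasCompactSupport.intro hKt fun x hx => by simp [hχt, hx]
    have hutc : Continuous ut := hcρ.continuous_convolution_left _ hρc hχti.locallyIntegrable
    have hcut : HasCompactSupport ut := hcρ.convolution _ hcχt
    -- `∫ (u_t - u) = ((1-t)ⁿ - 1) V`
    have hvolt : (volume ((1 - t) • K)).toReal = (1 - t) ^ n * V := by
      rw [Measure.addHaar_smul, finrank_euclideanSpace, Fintype.card_fin, ENNReal.toReal_mul,
        ENNReal.toReal_ofReal (abs_nonneg _), abs_of_nonneg (pow_nonneg (by linarith [ht.2]) _)]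
    have hint_t : ∫ x, (ut x - u x) = ((1 - t) ^ n - 1) * V := by
      rw [integral_sub (hutc.integrable_of_hasCompactSupport hcut)
          (hud.continuous.integrable_of_hasCompactSupport hcu),
        hut, hu, integral_convolution_indicator hρc hcρ hKtm hKt.measure_lt_top,
        integral_convolution_indicator hρc hcρ hKm hKfin, hρ1, hvolt]
      ring
    -- pointwise erosion and integration
    have hmono : ∫ x, (ut x - u x) ≤ ∫ x, F t x := by
      have hcF : HasCompactSupport (F t) := by
        refine hcφ.mono fun x hx => ?_
        rw [mem_support] at hx ⊢
        contrapose! hx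
        simp [hF, hx]
      refine integral_mono ((hutc.sub hud.continuous).integrable_of_hasCompactSupport
          (hcut.sub hcu)) ((hFc t).integrable_of_hasCompactSupport hcF) fun x => ?_
      simp only [hF]
      exact sub_le_sub_right (convolution_indicator_smul_le hρc hcρ hρ0 hKc hKm ht.1.le ht.2
        (hφK x) x) _
    -- Bernoulli
    have hbern : 1 - n * t ≤ (1 - t) ^ n := by
      have h := one_add_mul_le_pow (a := -t) (by linarith [ht.2]) n
      simpa [sub_eq_add_neg, mul_neg] using h
    have hV0 : 0 ≤ V := ENNReal.toReal_nonneg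
    calc -(n * t * V) ≤ ((1 - t) ^ n - 1) * V := by nlinarith
      _ = ∫ x, (ut x - u x) := hint_t.symm
      _ ≤ ∫ x, F t x := hmono
  -- conclusion from the right derivative at `0`
  have hslope := hderiv.tendsto_slope_zero_right
  have hev : ∀ᶠ t in 𝓝[>] (0 : ℝ), -(n * V) ≤ t⁻¹ • ((∫ x, F (0 + t) x) - ∫ x, F 0 x) := by
    filter_upwards [Ioc_mem_nhdsGT (zero_lt_one' ℝ)] with t ht
    rw [hG0, sub_zero, zero_add, smul_eq_mul]
    have htne : t ≠ 0 := ht.1.ne'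
    have h := hGt t ht
    calc -(n * V) = t⁻¹ * (-(n * t * V)) := by field_simp
      _ ≤ t⁻¹ * ∫ x, F t x := mul_le_mul_of_nonneg_left h (inv_nonneg.2 ht.1.le)
  have hlim : -(n * V) ≤ ∫ x, F' 0 x := ge_of_tendsto hslope hev
  have hF'0 : (∫ x, F' 0 x) = ∫ x, fderiv ℝ u x (φ x) := by simp [hF']
  linarith [hlim, hF'0]

/-! ### Integration by parts against a `C¹_c` field -/

/-- Coordinate projections of a `C¹` field are `C¹`. [folklore] -/
private theorem contDiff_apply {φ : EuclideanSpace ℝ (Fin n) → EuclideanSpace ℝ (Fin n)}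
    (hφ : ContDiff ℝ 1 φ) (i : Fin n) : ContDiff ℝ 1 fun y => φ y i :=
  contDiff_euclidean.1 hφ i

/-- `D(φ_i)(x) v = (Dφ(x) v)_i`. [folklore] -/
private theorem fderiv_apply_coord {φ : EuclideanSpace ℝ (Fin n) → EuclideanSpace ℝ (Fin n)}
    (hφ : ContDiff ℝ 1 φ) (x v : EuclideanSpace ℝ (Fin n)) (i : Fin n) :
    fderiv ℝ (fun y => φ y i) x v = (fderiv ℝ φ x v) i := by
  have h := (hasFDerivWithinAt_euclidean.1
    (((hφ.differentiable one_ne_zero) x).hasFDerivAt.hasFDerivWithinAt (s := univ))) i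
  rw [(hasFDerivWithinAt_univ.1 h).fderiv]
  simp

/-- The divergence of a `C¹` field is continuous (plumbing for `div φ`, `φ ∈ C¹_c(ℝⁿ; ℝⁿ)`).
[cite: EvansGariepy2015, §5.1 Definition 5.1 (the test fields `φ ∈ C¹_c`, `div φ`) — plumbing] -/
theorem continuous_fieldDivergence_of_contDiff
    {φ : EuclideanSpace ℝ (Fin n) → EuclideanSpace ℝ (Fin n)} (hφ : ContDiff ℝ 1 φ) :
    Continuous (fieldDivergence φ) := by
  have : fieldDivergence φ = fun x => ∑ i, (fderiv ℝ φ x (EuclideanSpace.single i 1)) i := by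
    funext x; exact fieldDivergence_eq_sum φ x
  rw [this]
  refine continuous_finsetSum _ fun i _ => ?_
  exact (EuclideanSpace.proj i).continuous.comp
    ((hφ.continuous_fderiv one_ne_zero).clm_apply continuous_const)

/-- The divergence of a compactly supported field is compactly supported (plumbing for `div φ`,
`φ ∈ C¹_c(ℝⁿ; ℝⁿ)`).
[cite: EvansGariepy2015, §5.1 Definition 5.1 (the test fields `φ ∈ C¹_c`, `div φ`) — plumbing] -/
theorem hasCompactSupport_fieldDivergence
    {φ : EuclideanSpace ℝ (Fin n) → EuclideanSpace ℝ (Fin n)} (hcφ : HasCompactSupport φ) :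
    HasCompactSupport (fieldDivergence φ) := by
  have : fieldDivergence φ =
      (fun A : EuclideanSpace ℝ (Fin n) →L[ℝ] EuclideanSpace ℝ (Fin n) =>
        LinearMap.trace ℝ _ (A : EuclideanSpace ℝ (Fin n) →ₗ[ℝ] EuclideanSpace ℝ (Fin n))) ∘
        fderiv ℝ φ := rfl
  rw [this]
  exact (hcφ.fderiv (𝕜 := ℝ)).comp_left (by simp)

/-- **Integration by parts against a `C¹_c` field:** for `u ∈ C¹_c(ℝⁿ)` and `φ ∈ C¹_c(ℝⁿ; ℝⁿ)`,
`∫ Du(x)[φ(x)] dx = -∫ u · div φ` — Evans–Gariepy's first example after the definition of `BV`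
("Assume `f ∈ W^{1,1}_loc(U)`. Then … `∫_U f div φ dx = -∫_U Df · φ dx`"), in the case `f ∈ C¹_c`.
(Coordinatewise `∫ ∂ᵢu · φᵢ = -∫ u · ∂ᵢφᵢ`, Mathlib's `LipschitzWith.integral_lineDeriv_mul_eq`.)
[cite: EvansGariepy2015, §5.1, Example following Definition 5.1 (`W^{1,1} ⊂ BV`)] -/
theorem integral_fderiv_apply_eq_neg_integral_mul_fieldDivergence
    {u : EuclideanSpace ℝ (Fin n) → ℝ} (hu : ContDiff ℝ 1 u) (hcu : HasCompactSupport u)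
    {φ : EuclideanSpace ℝ (Fin n) → EuclideanSpace ℝ (Fin n)} (hφ : ContDiff ℝ 1 φ)
    (hcφ : HasCompactSupport φ) :
    ∫ x, fderiv ℝ u x (φ x) = -∫ x, u x * fieldDivergence φ x := by
  have hud : Differentiable ℝ u := hu.differentiable one_ne_zero
  have huc : Continuous u := hu.continuous
  have hDuc : Continuous (fderiv ℝ u) := hu.continuous_fderiv one_ne_zero
  obtain ⟨Cu, hCu⟩ := hu.lipschitzWith_of_hasCompactSupport hcu one_ne_zero
  -- coordinates of `φ`
  have hφi : ∀ i, ContDiff ℝ 1 fun y => φ y i := contDiff_apply hφ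
  have hcφi : ∀ i, HasCompactSupport fun y => φ y i := fun i =>
    hcφ.comp_left (g := fun v : EuclideanSpace ℝ (Fin n) => v i) rfl
  have hφic : ∀ i, Continuous fun y => φ y i := fun i => (hφi i).continuous
  have hLφ : ∀ i, ∃ D, LipschitzWith D fun y => φ y i := fun i =>
    (hφi i).lipschitzWith_of_hasCompactSupport (hcφi i) one_ne_zero
  -- Step 1: `Du(x)[φ x] = Σ_i φ_i(x) ∂_i u(x)`
  set e : Fin n → EuclideanSpace ℝ (Fin n) := fun i => EuclideanSpace.single i 1 with he
  have h1 : ∀ x, fderiv ℝ u x (φ x) = ∑ i, fderiv ℝ u x (e i) * φ x i := by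
    intro x
    conv_lhs => rw [← (EuclideanSpace.basisFun (Fin n) ℝ).sum_repr (φ x)]
    rw [_root_.map_sum]
    refine Finset.sum_congr rfl fun i _ => ?_
    rw [map_smul, EuclideanSpace.basisFun_apply, EuclideanSpace.basisFun_repr, smul_eq_mul,
      mul_comm]
  -- integrability of the coordinate terms
  have hint1 : ∀ i, Integrable (fun x => fderiv ℝ u x (e i) * φ x i) volume := fun i =>
    ((hDuc.clm_apply continuous_const).mul (hφic i)).integrable_of_hasCompactSupport
      (hcφi i).mul_left
  have hint2 : ∀ i, Integrable (fun x => u x * fderiv ℝ (fun y => φ y i) x (e i)) volume :=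
    fun i => (huc.mul (((hφi i).continuous_fderiv one_ne_zero).clm_apply continuous_const))
      |>.integrable_of_hasCompactSupport hcu.mul_right
  -- Step 2: coordinatewise integration by parts
  have h2 : ∀ i, ∫ x, fderiv ℝ u x (e i) * φ x i =
      -∫ x, u x * fderiv ℝ (fun y => φ y i) x (e i) := by
    intro i
    obtain ⟨D, hD⟩ := hLφ i
    have h := hCu.integral_lineDeriv_mul_eq hD (hcφi i) (e i) (μ := volume)
    have hl : ∀ x, lineDeriv ℝ u x (e i) = fderiv ℝ u x (e i) := fun x =>
      (hud x).lineDeriv_eq_fderiv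
    have hl' : ∀ x, lineDeriv ℝ (fun y => φ y i) x (-e i) = -fderiv ℝ (fun y => φ y i) x (e i) :=
      fun x => by
        rw [(((hφi i).differentiable one_ne_zero) x).lineDeriv_eq_fderiv, map_neg]
    simp_rw [hl, hl'] at h
    rw [h, ← integral_neg]
    refine integral_congr_ae (Eventually.of_forall fun x => ?_)
    simp only; ring
  -- Step 3: sum up
  rw [integral_congr_ae (Eventually.of_forall h1), integral_finsetSum _ fun i _ => hint1 i]
  simp_rw [h2]
  rw [Finset.sum_neg_distrib, ← integral_finsetSum _ fun i _ => hint2 i]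
  congr 1
  refine integral_congr_ae (Eventually.of_forall fun x => ?_)
  simp only
  rw [← Finset.mul_sum, fieldDivergence_eq_sum]
  congr 1
  exact Finset.sum_congr rfl fun i _ => fderiv_apply_coord hφ x (e i) i

/-! ### The upper bound `∫_K div φ ≤ n · vol(K)` and `P_K(K) ≤ n · vol(K)` -/

/-- **Every admissible `K`-valued field has `∫_K div φ ≤ n · vol(K)`** (`K` compact convex, any
dimension): mollify `χ_K` by bump kernels `ρ_k`, integrate by parts
(`∫ u_k div φ = -∫ Du_k[φ] ≤ n |K|` by the inner-variation estimate), and pass to the limit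
`u_k → χ_K` a.e. (Lebesgue differentiation) by dominated convergence.
[cite: Maggi2012, Proposition 20.10 (iii), eq. (20.11) p. 263 (the inequality `≤`)] -/
theorem setIntegral_fieldDivergence_self_le {K : Set (EuclideanSpace ℝ (Fin n))}
    (hK : IsCompact K) (hKc : Convex ℝ K)
    {φ : EuclideanSpace ℝ (Fin n) → EuclideanSpace ℝ (Fin n)} (hφ : ContDiff ℝ 1 φ)
    (hcφ : HasCompactSupport φ) (hφK : ∀ x, φ x ∈ K) :
    ∫ x in K, fieldDivergence φ x ≤ n * (volume K).toReal := by
  have hKm : MeasurableSet K := hK.isClosed.measurableSet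
  have hKfin : volume K < ⊤ := hK.measure_lt_top
  set χ : EuclideanSpace ℝ (Fin n) → ℝ := K.indicator fun _ => (1 : ℝ) with hχ_def
  have hχi : Integrable χ volume := (integrable_indicator_iff hKm).2 (integrableOn_const hKfin.ne)
  have hcχ : HasCompactSupport χ := HasCompactSupport.intro hK fun x hx => by simp [hχ_def, hx]
  have hdivc : Continuous (fieldDivergence φ) := continuous_fieldDivergence_of_contDiff hφ
  have hdivs : HasCompactSupport (fieldDivergence φ) := hasCompactSupport_fieldDivergence hcφ
  have hdivi : Integrable (fieldDivergence φ) volume := hdivc.integrable_of_hasCompactSupport hdivs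
  -- bump functions at `0` with radii `rIn = 1/(k+2)`, `rOut = 2/(k+2)`
  have hbump : ∀ k : ℕ, ∃ b : ContDiffBump (0 : EuclideanSpace ℝ (Fin n)),
      b.rOut = 2 * ((k : ℝ) + 2)⁻¹ ∧ b.rOut = 2 * b.rIn := fun k =>
    ⟨⟨((k : ℝ) + 2)⁻¹, 2 * ((k : ℝ) + 2)⁻¹, by positivity, by
      have : (0 : ℝ) < ((k : ℝ) + 2)⁻¹ := by positivity
      linarith⟩, rfl, rfl⟩
  choose bumpSeq hbOut hbRatio using hbump
  set ρ : ℕ → EuclideanSpace ℝ (Fin n) → ℝ := fun k => (bumpSeq k).normed volume with hρ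
  set u : ℕ → EuclideanSpace ℝ (Fin n) → ℝ := fun k => ρ k ⋆[lsmul ℝ ℝ, volume] χ with hu
  have hρC : ∀ k, ContDiff ℝ 1 (ρ k) := fun k => (bumpSeq k).contDiff_normed
  have hρs : ∀ k, HasCompactSupport (ρ k) := fun k => (bumpSeq k).hasCompactSupport_normed
  have hρ0 : ∀ k s, 0 ≤ ρ k s := fun k s => (bumpSeq k).nonneg_normed s
  have hρ1 : ∀ k, ∫ s, ρ k s = 1 := fun k => (bumpSeq k).integral_normed
  have huC : ∀ k, ContDiff ℝ 1 (u k) := fun k =>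
    (hρs k).contDiff_convolution_left _ (hρC k) hχi.locallyIntegrable
  have hcu : ∀ k, HasCompactSupport (u k) := fun k => (hρs k).convolution _ hcχ
  -- (1) each mollified indicator: `∫ u_k div φ ≤ n vol(K)`
  have hk : ∀ k, ∫ x, u k x * fieldDivergence φ x ≤ n * (volume K).toReal := by
    intro k
    have h1 := integral_fderiv_apply_eq_neg_integral_mul_fieldDivergence (huC k) (hcu k) hφ hcφ
    have h2 := neg_integral_fderiv_convolution_indicator_apply_le (hρC k) (hρs k) (hρ0 k) (hρ1 k)
      hK hKc hφ.continuous hcφ hφK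
    have h3 : -(∫ x, fderiv ℝ (u k) x (φ x)) = ∫ x, u k x * fieldDivergence φ x := by
      rw [h1, neg_neg]
    rw [← h3]; exact h2
  -- (2) `u_k → χ_K` a.e. (Lebesgue differentiation)
  have hae : ∀ᵐ x, Tendsto (fun k => u k x) atTop (𝓝 (χ x)) := by
    have hφr : Tendsto (fun k => (bumpSeq k).rOut) atTop (𝓝 0) := by
      simp only [hbOut]
      have h1 : Tendsto (fun k : ℕ => ((k : ℝ) + 2)⁻¹) atTop (𝓝 0) := by
        have := tendsto_one_div_add_atTop_nhds_zero_nat (𝕜 := ℝ)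
        have h2 : Tendsto (fun k : ℕ => 1 / ((↑(k + 1) : ℝ) + 1)) atTop (𝓝 0) :=
          this.comp (tendsto_add_atTop_nat 1)
        refine h2.congr fun k => ?_
        push_cast; ring
      have := h1.const_mul 2
      rw [mul_zero] at this
      exact this
    have h'φ : ∀ᶠ k in atTop, (bumpSeq k).rOut ≤ 2 * (bumpSeq k).rIn :=
      Eventually.of_forall fun k => (hbRatio k).le
    exact ContDiffBump.ae_convolution_tendsto_right_of_locallyIntegrable hφr h'φ
      hχi.locallyIntegrable
  -- (3) dominated convergence: `∫ u_k div φ → ∫ χ_K div φ = ∫_K div φ`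
  have hlim : Tendsto (fun k => ∫ x, u k x * fieldDivergence φ x) atTop
      (𝓝 (∫ x in K, fieldDivergence φ x)) := by
    have hset : ∫ x in K, fieldDivergence φ x = ∫ x, χ x * fieldDivergence φ x := by
      rw [← integral_indicator hKm]
      refine integral_congr_ae (Eventually.of_forall fun x => ?_)
      by_cases hx : x ∈ K <;> simp [hχ_def, hx]
    rw [hset]
    refine tendsto_integral_of_dominated_convergence (fun x => ‖fieldDivergence φ x‖)
      (fun k => ?_) hdivi.norm (fun k => Eventually.of_forall fun x => ?_) ?_
    · exact (((hρs k).continuous_convolution_left _ (hρC k).continuous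
        hχi.locallyIntegrable).mul hdivc).aestronglyMeasurable
    · rw [norm_mul]
      refine mul_le_of_le_one_left (norm_nonneg _) ?_
      have hm := convolution_indicator_mem_Icc (hρC k).continuous (hρs k) (hρ0 k) hKm x
      rw [hρ1 k] at hm
      rw [Real.norm_of_nonneg hm.1]; exact hm.2
    · filter_upwards [hae] with x hx using hx.mul_const _
  exact le_of_tendsto' hlim hk

/-- **Upper bound `P_K(K) ≤ n · vol(K)`** for every compact convex `K ⊆ ℝⁿ` (any `n`; `0 ∈ K` not
needed). [cite: Maggi2012, Proposition 20.10 (iii), eq. (20.11) p. 263 (the inequality `≤`)] -/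
theorem anisotropicPerimeter_self_le {K : Set (EuclideanSpace ℝ (Fin n))} (hK : IsCompact K)
    (hKc : Convex ℝ K) : anisotropicPerimeter K K ≤ (n : ℝ≥0∞) * volume K := by
  have hKfin : volume K < ⊤ := hK.measure_lt_top
  refine anisotropicPerimeter_le_iff.2 fun φ h₁ h₂ h₃ => ?_
  calc ENNReal.ofReal (∫ x in K, fieldDivergence φ x)
      ≤ ENNReal.ofReal (n * (volume K).toReal) :=
        ENNReal.ofReal_le_ofReal (setIntegral_fieldDivergence_self_le hK hKc h₁ h₂ h₃)
    _ = (n : ℝ≥0∞) * volume K := by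
        rw [ENNReal.ofReal_mul (Nat.cast_nonneg n), ENNReal.ofReal_natCast,
          ENNReal.ofReal_toReal hKfin.ne]

/-- **The Wulff shape's own anisotropic perimeter: `P_K(K) = n · vol(K)`** for `n ≥ 2` and `K ⊆ ℝⁿ`
compact convex with `0 ∈ K` (Maggi: `Φ(W_Φ) = n |W_Φ|`; here `Φ = h_K`, `W̄_Φ = K`). The lower bound
is the Wulff inequality `anisotropic_isoperimetric_inequality` with `G = K`; the upper bound is
`anisotropicPerimeter_self_le`. [cite: Maggi2012, Proposition 20.10 (iii), eq. (20.11) p. 263] -/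
theorem anisotropicPerimeter_self (hn : 2 ≤ n) {K : Set (EuclideanSpace ℝ (Fin n))}
    (hK : IsCompact K) (hKc : Convex ℝ K) (h0K : (0 : EuclideanSpace ℝ (Fin n)) ∈ K) :
    anisotropicPerimeter K K = (n : ℝ≥0∞) * volume K := by
  refine le_antisymm (anisotropicPerimeter_self_le hK hKc) ?_
  have hn1 : 1 ≤ n := by omega
  have h := anisotropic_isoperimetric_inequality hn hK hKc h0K hK.isClosed.measurableSet
    hK.measure_lt_top
  have hpow : volume K ^ (n⁻¹ : ℝ) * (volume K ^ (n⁻¹ : ℝ)) ^ (n - 1) = volume K := by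
    rw [← pow_succ', Nat.sub_add_cancel hn1, ← ENNReal.rpow_natCast, ← ENNReal.rpow_mul,
      inv_mul_cancel₀ (by exact_mod_cast (by omega : n ≠ 0)), ENNReal.rpow_one]
  rw [mul_assoc, hpow] at h
  exact h

/-- **Real-valued form:** `(P_K(K)).toReal = n · vol(K)` under the same hypotheses.
[cite: Maggi2012, Proposition 20.10 (iii), eq. (20.11) p. 263] -/
theorem toReal_anisotropicPerimeter_self (hn : 2 ≤ n) {K : Set (EuclideanSpace ℝ (Fin n))}
    (hK : IsCompact K) (hKc : Convex ℝ K) (h0K : (0 : EuclideanSpace ℝ (Fin n)) ∈ K) :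
    (anisotropicPerimeter K K).toReal = n * (volume K).toReal := by
  rw [anisotropicPerimeter_self hn hK hKc h0K, ENNReal.toReal_mul, ENNReal.toReal_natCast]

/-! ### The isotropic case: the perimeter of a ball -/

/-- **The perimeter of a closed ball:** `Per(B̄(0, r)) = n · r^{n-1} · vol(B̄(0, 1))` in `ℝⁿ`,
`n ≥ 2`, `r > 0` (`= n ω_n r^{n-1} = H^{n-1}(∂B_r)`), for De Giorgi's distributional perimeter of
`FccTexturedSet.lean`: `Per = P_{B̄₁}` and `P_{B̄_r}(B̄_r) = n |B̄_r|`.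
[cite: Maggi2012, Example 20.9 p. 262 and eq. (20.11)] -/
theorem perimeter_closedBall (hn : 2 ≤ n) {r : ℝ} (hr : 0 < r) :
    perimeter (closedBall (0 : EuclideanSpace ℝ (Fin n)) r) =
      (n : ℝ≥0∞) * ENNReal.ofReal (r ^ (n - 1)) *
        volume (closedBall (0 : EuclideanSpace ℝ (Fin n)) 1) := by
  have hn1 : 1 ≤ n := by omega
  have hself := anisotropicPerimeter_self hn (isCompact_closedBall (0 : EuclideanSpace ℝ (Fin n)) r)
    (convex_closedBall 0 r) (mem_closedBall_self hr.le)
  have hscale : closedBall (0 : EuclideanSpace ℝ (Fin n)) r =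
      r • closedBall (0 : EuclideanSpace ℝ (Fin n)) 1 := by
    rw [_root_.smul_closedBall _ _ zero_le_one, smul_zero, mul_one, Real.norm_of_nonneg hr.le]
  have hP : anisotropicPerimeter (closedBall (0 : EuclideanSpace ℝ (Fin n)) r)
      (closedBall (0 : EuclideanSpace ℝ (Fin n)) r) =
      ENNReal.ofReal r * perimeter (closedBall (0 : EuclideanSpace ℝ (Fin n)) r) := by
    conv_lhs => rw [hscale]
    rw [anisotropicPerimeter_smul_left hr, ← hscale, perimeter_eq_anisotropicPerimeter_closedBall]
  have hvol : volume (closedBall (0 : EuclideanSpace ℝ (Fin n)) r) =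
      ENNReal.ofReal (r ^ n) * volume (closedBall (0 : EuclideanSpace ℝ (Fin n)) 1) := by
    rw [hscale, Measure.addHaar_smul, finrank_euclideanSpace, Fintype.card_fin,
      abs_of_nonneg (pow_nonneg hr.le _)]
  rw [hP, hvol] at hself
  have hr' : ENNReal.ofReal r ≠ 0 := by rwa [Ne, ENNReal.ofReal_eq_zero, not_le]
  have hrn : ENNReal.ofReal (r ^ n) = ENNReal.ofReal r * ENNReal.ofReal (r ^ (n - 1)) := by
    rw [← ENNReal.ofReal_mul hr.le, ← pow_succ', Nat.sub_add_cancel hn1]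
  rw [hrn] at hself
  have : ENNReal.ofReal r * perimeter (closedBall (0 : EuclideanSpace ℝ (Fin n)) r) =
      ENNReal.ofReal r * ((n : ℝ≥0∞) * ENNReal.ofReal (r ^ (n - 1)) *
        volume (closedBall (0 : EuclideanSpace ℝ (Fin n)) 1)) := by
    rw [hself]; ring
  exact (ENNReal.mul_right_inj hr' ENNReal.ofReal_ne_top).1 this

end Literature.Analysis.Convexity

end
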